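import Mathlib
import Summits.KontsevichZagierPeriods.KontsevichZagierPeriods.Theses.InverseLandau
import Literature.NumberTheory.Transcendental.KZCalculus
import Literature.NumberTheory.Transcendental.KZLogCalculusProofs
import Literature.NumberTheory.Transcendental.KZProductIdeal
import Literature.NumberTheory.Transcendental.KZBetaChains
import Literature.NumberTheory.Transcendental.SemialgebraicRpow
import Summits.KontsevichZagierPeriods.KontsevichZagierPeriods.Theorems.BetaCancellation.Negative.Torsion
import Summits.KontsevichZagierPeriods.KontsevichZagierPeriods.Theorems.BetaCancellation.Negative.PiLink

/-!
# `TateLifting` (stmt-KontsevichZagierPeriods-9129), line `Sketch` — stub 74 `tateLifting_depolarisationSum`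

The DEPOLARISATION SUM of the genus-one calibration of route `VietaFibre` (item
stmt-KontsevichZagierPeriods-5153 `DepolarisationSum`, verbatim), inside the Kontsevich–Zagier
calculus of moves. For rationals `a, b, c > 0` put `D_α(x) = α²(1 − x) + x` (`α ∈ {a, b, c}`;
`D_α > 0` on `[0,1]`) and

  `f(x) = abc · √(1 − x) / √(D_a D_b D_c) · (1/D_a + 1/D_b + 1/D_c)`.

**Theorem** (`tateLifting_depolarisationSum`). Every representation `r = [(0,1), f]` (pinned by its
domain `{x | x 0 ∈ (0,1)} ⊆ ℝ¹` and by its integrand on it) is `KZ.Equivalent` to every constant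
representation `r' = [pt, 2]` over the point `ℝ⁰` (domain `univ`, integrand `2` on it); in
particular `∫₀¹ f = 2` for all `a, b, c`.

**Proof.** ONE Newton–Leibniz move over the point (KZ's rule (3), `KZ.newtonLeibnizRel` with
`n = 0`, band `[0,1]`, `a = 0`, `b = 1`) with the explicit ALGEBRAIC primitive

  `G(x) = −2abc · (1 − x)^{3/2} / √(D_a(x) D_b(x) D_c(x))`:

`G' = f` on `(0,1)` (logarithmic derivative: `G'/G = −3/(2(1−x)) − ½ Σ (1 − α²)/D_α`, and
`3 + Σ (1 − α²)(1 − x)/D_α = Σ (D_α + (1 − x) − α²(1 − x))/D_α = Σ 1/D_α`; in Lean: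
`hasDerivAt_depolPrim`, the polynomial identity being `depol_core`), `G` is continuous on `[0,1]`,
`G(1) = 0` and `G(0) = −2abc/√(a²b²c²) = −2`, so `G(1) − G(0) = 2`. Both `f` and `G` are
`ℚ`-semialgebraic on `[0,1]` (polynomials, one square root of a polynomial and the inverse square
root of a positive polynomial, closed under products and sums by Tarski–Seidenberg:
`IsSemialgebraicFunOn.mul_holds/add_holds/sqrt_holds`, `isSemialgebraicFunOn_aeval_div_aeval`).
The glue `equivalent_of_newtonLeibniz_point` is the general pattern "pinned `[(0,1), g] ∼ [pt, v]`
from a primitive `F` with `F(1) − F(0) = v`": the band representation `[[0,1], g]` (integrable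
because `r` is and the two boundary points are null), the move `[[0,1], g] − [r'] ∈
newtonLeibnizRel`, dropping the null boundary (`KZ.IntegralRep.of_sub_of_restrict_mem_relations`)
and congruence of integrands on `(0,1)` (`KZ.of_sub_of_mem_relations_of_eqOn`).

Pattern of `Theorems/BetaCancellation/Negative/PiLinkMoves.lean` (`derivRep_sub_zeroRep0_mem`) and
of `Literature/.../KZBetaChains.lean` (`betaTranslation_equivalent`). Sorry-free; axioms ⊆
{propext, Classical.choice, Quot.sound}.

References: M. Kontsevich, D. Zagier, *Periods* (2001), §1.2 (rules (1)–(3)); J. Bochnak,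
M. Coste, M.-F. Roy, *Real Algebraic Geometry* (1998), §2.2.
-/

noncomputable section

open MeasureTheory Set
open Literature.NumberTheory.Transcendental
open Literature.ModelTheory.ExponentialFields (IsSemialgebraic isSemialgebraic_univ)
open MvPolynomial (aeval X C)
open Summit.KontsevichZagierPeriods.KontsevichZagierPeriods.BetaCancellationNegative
  (isSemialgebraicFunOn_of_eqOn_inv_sqrt)

namespace Summit.KontsevichZagierPeriods.InverseLandau

/-! ### §1 The fibre denominators `D_α(t) = α²(1 − t) + t` -/

/-- `D_α(t) = α²(1 − t) + t > 0` for `α > 0` and `t ∈ [0,1]` (a convex combination of `α²` and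
`1`). [folklore] -/
theorem depol_den_pos {α t : ℝ} (hα : 0 < α) (ht0 : 0 ≤ t) (ht1 : t ≤ 1) :
    0 < α ^ 2 * (1 - t) + t := by
  rcases ht1.lt_or_eq with h | h
  · have : 0 < α ^ 2 * (1 - t) := mul_pos (pow_pos hα 2) (by linarith)
    linarith
  · rw [h]
    norm_num

/-- `D_a D_b D_c > 0` on `[0,1]`. [folklore] -/
theorem depol_prod_pos {A B C t : ℝ} (hA : 0 < A) (hB : 0 < B) (hC : 0 < C) (ht0 : 0 ≤ t)
    (ht1 : t ≤ 1) :
    0 < (A ^ 2 * (1 - t) + t) * (B ^ 2 * (1 - t) + t) * (C ^ 2 * (1 - t) + t) :=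
  mul_pos (mul_pos (depol_den_pos hA ht0 ht1) (depol_den_pos hB ht0 ht1)) (depol_den_pos hC ht0 ht1)

/-! ### §2 The primitive `G = −2abc (1−t)^{3/2} / √(D_a D_b D_c)` and its derivative -/

/-- `d/dt ((1 − t)√(1 − t)) = −(3/2)√(1 − t)` for `t < 1`. [folklore] -/
theorem hasDerivAt_one_sub_mul_sqrt {t : ℝ} (ht : t < 1) :
    HasDerivAt (fun s : ℝ => (1 - s) * √(1 - s)) (-(3 / 2) * √(1 - t)) t := by
  have hpos : 0 < 1 - t := sub_pos.2 ht
  have h1 : HasDerivAt (fun s : ℝ => 1 - s) (-1) t := (hasDerivAt_id' t).const_sub 1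
  have h2 : HasDerivAt (fun s : ℝ => √(1 - s)) (-1 / (2 * √(1 - t))) t := h1.sqrt hpos.ne'
  refine (h1.fun_mul h2).congr_deriv ?_
  have hw0 : √(1 - t) ≠ 0 := (Real.sqrt_pos.2 hpos).ne'
  have hw2 : √(1 - t) ^ 2 = 1 - t := Real.sq_sqrt hpos.le
  generalize √(1 - t) = w at hw0 hw2 ⊢
  rw [← hw2]
  field_simp
  ring

/-- **The algebraic identity behind `G' = f`.** With `w = √(1 − t)`, `q = √(D_a D_b D_c)`
(so `q² = D_a D_b D_c`) the quotient-rule expression for `G'` equals the integrand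
`abc · w/q · (1/D_a + 1/D_b + 1/D_c)`: both are `abc · w · (Σ D_β D_γ)/(q · D_a D_b D_c)`, by the
polynomial identity `3 D_a D_b D_c + (1 − t)·(D_a D_b D_c)' = D_b D_c + D_a D_c + D_a D_b`
(from `(1 − t)(1 − α²) = 1 − D_α`). [folklore] -/
theorem depol_core {A B C t w q : ℝ}
    (hq2 : q ^ 2 = (A ^ 2 * (1 - t) + t) * (B ^ 2 * (1 - t) + t) * (C ^ 2 * (1 - t) + t))
    (hq0 : q ≠ 0) (hDa : A ^ 2 * (1 - t) + t ≠ 0) (hDb : B ^ 2 * (1 - t) + t ≠ 0)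
    (hDc : C ^ 2 * (1 - t) + t ≠ 0) :
    (-2 * (A * B * C) * (-(3 / 2) * w) * q -
        -2 * (A * B * C) * ((1 - t) * w) *
          ((((A ^ 2 * -1 + 1) * (B ^ 2 * (1 - t) + t) + (A ^ 2 * (1 - t) + t) * (B ^ 2 * -1 + 1)) *
              (C ^ 2 * (1 - t) + t) +
            (A ^ 2 * (1 - t) + t) * (B ^ 2 * (1 - t) + t) * (C ^ 2 * -1 + 1)) / (2 * q))) / q ^ 2 =
      A * B * C * w / q *
        (1 / (A ^ 2 * (1 - t) + t) + 1 / (B ^ 2 * (1 - t) + t) + 1 / (C ^ 2 * (1 - t) + t)) := by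
  have key : 3 * q ^ 2 + (1 - t) *
      (((A ^ 2 * -1 + 1) * (B ^ 2 * (1 - t) + t) + (A ^ 2 * (1 - t) + t) * (B ^ 2 * -1 + 1)) *
          (C ^ 2 * (1 - t) + t) +
        (A ^ 2 * (1 - t) + t) * (B ^ 2 * (1 - t) + t) * (C ^ 2 * -1 + 1)) =
      (B ^ 2 * (1 - t) + t) * (C ^ 2 * (1 - t) + t) + (A ^ 2 * (1 - t) + t) * (C ^ 2 * (1 - t) + t) +
        (A ^ 2 * (1 - t) + t) * (B ^ 2 * (1 - t) + t) := by
    rw [hq2]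
    ring
  have eL : (-2 * (A * B * C) * (-(3 / 2) * w) * q -
        -2 * (A * B * C) * ((1 - t) * w) *
          ((((A ^ 2 * -1 + 1) * (B ^ 2 * (1 - t) + t) + (A ^ 2 * (1 - t) + t) * (B ^ 2 * -1 + 1)) *
              (C ^ 2 * (1 - t) + t) +
            (A ^ 2 * (1 - t) + t) * (B ^ 2 * (1 - t) + t) * (C ^ 2 * -1 + 1)) / (2 * q))) / q ^ 2 =
      A * B * C * w * (3 * q ^ 2 + (1 - t) *
        (((A ^ 2 * -1 + 1) * (B ^ 2 * (1 - t) + t) + (A ^ 2 * (1 - t) + t) * (B ^ 2 * -1 + 1)) *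
            (C ^ 2 * (1 - t) + t) +
          (A ^ 2 * (1 - t) + t) * (B ^ 2 * (1 - t) + t) * (C ^ 2 * -1 + 1))) / q ^ 3 := by
    field_simp
    ring
  have eR : A * B * C * w / q *
        (1 / (A ^ 2 * (1 - t) + t) + 1 / (B ^ 2 * (1 - t) + t) + 1 / (C ^ 2 * (1 - t) + t)) =
      A * B * C * w * ((B ^ 2 * (1 - t) + t) * (C ^ 2 * (1 - t) + t) +
          (A ^ 2 * (1 - t) + t) * (C ^ 2 * (1 - t) + t) + (A ^ 2 * (1 - t) + t) * (B ^ 2 * (1 - t) + t)) /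
        (q * ((A ^ 2 * (1 - t) + t) * (B ^ 2 * (1 - t) + t) * (C ^ 2 * (1 - t) + t))) := by
    field_simp
  rw [eL, eR, key, show q ^ 3 = q * q ^ 2 by ring, hq2]

/-- **`G' = f` on `(0,1)`**: the primitive `G(t) = −2abc (1 − t)√(1 − t)/√(D_a D_b D_c)` has
derivative `abc √(1 − t)/√(D_a D_b D_c) · (1/D_a + 1/D_b + 1/D_c)` at every `t ∈ (0,1)`
(`a, b, c > 0` real). [folklore] -/
theorem hasDerivAt_depolPrim {A B C t : ℝ} (hA : 0 < A) (hB : 0 < B) (hC : 0 < C)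
    (ht : t ∈ Ioo (0:ℝ) 1) :
    HasDerivAt (fun s : ℝ => -2 * (A * B * C) * ((1 - s) * √(1 - s)) /
        √((A ^ 2 * (1 - s) + s) * (B ^ 2 * (1 - s) + s) * (C ^ 2 * (1 - s) + s)))
      (A * B * C * √(1 - t) /
          √((A ^ 2 * (1 - t) + t) * (B ^ 2 * (1 - t) + t) * (C ^ 2 * (1 - t) + t)) *
        (1 / (A ^ 2 * (1 - t) + t) + 1 / (B ^ 2 * (1 - t) + t) + 1 / (C ^ 2 * (1 - t) + t))) t := by
  have hDa := depol_den_pos hA ht.1.le ht.2.le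
  have hDb := depol_den_pos hB ht.1.le ht.2.le
  have hDc := depol_den_pos hC ht.1.le ht.2.le
  have hP : 0 < (A ^ 2 * (1 - t) + t) * (B ^ 2 * (1 - t) + t) * (C ^ 2 * (1 - t) + t) :=
    mul_pos (mul_pos hDa hDb) hDc
  have hq0 : √((A ^ 2 * (1 - t) + t) * (B ^ 2 * (1 - t) + t) * (C ^ 2 * (1 - t) + t)) ≠ 0 :=
    (Real.sqrt_pos.2 hP).ne'
  have h1 : HasDerivAt (fun s : ℝ => 1 - s) (-1) t := (hasDerivAt_id' t).const_sub 1
  have hD : ∀ α : ℝ, HasDerivAt (fun s : ℝ => α ^ 2 * (1 - s) + s) (α ^ 2 * -1 + 1) t :=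
    fun α => (h1.const_mul (α ^ 2)).fun_add (hasDerivAt_id' t)
  have hPd := ((hD A).fun_mul (hD B)).fun_mul (hD C)
  have hv := hPd.sqrt hP.ne'
  have hu := (hasDerivAt_one_sub_mul_sqrt ht.2).const_mul (-2 * (A * B * C))
  refine (hu.fun_div hv hq0).congr_deriv ?_
  exact depol_core (Real.sq_sqrt hP.le) hq0 hDa.ne' hDb.ne' hDc.ne'

/-- `G` is continuous on `[0,1]` (the denominator `√(D_a D_b D_c)` does not vanish there).
[folklore] -/
theorem continuousOn_depolPrim {A B C : ℝ} (hA : 0 < A) (hB : 0 < B) (hC : 0 < C) :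
    ContinuousOn (fun s : ℝ => -2 * (A * B * C) * ((1 - s) * √(1 - s)) /
        √((A ^ 2 * (1 - s) + s) * (B ^ 2 * (1 - s) + s) * (C ^ 2 * (1 - s) + s))) (Icc (0:ℝ) 1) := by
  have hnum : Continuous fun s : ℝ => -2 * (A * B * C) * ((1 - s) * √(1 - s)) := by fun_prop
  have hden : Continuous fun s : ℝ =>
      √((A ^ 2 * (1 - s) + s) * (B ^ 2 * (1 - s) + s) * (C ^ 2 * (1 - s) + s)) := by fun_prop
  refine hnum.continuousOn.div₀ hden.continuousOn fun s hs => ?_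
  exact (Real.sqrt_pos.2 (depol_prod_pos hA hB hC hs.1 hs.2)).ne'

/-- **`G(1) − G(0) = 2`**: `G(1) = 0` and `G(0) = −2abc/√(a²b²c²) = −2` for `a, b, c > 0`.
[folklore] -/
theorem depolPrim_one_sub_depolPrim_zero {A B C : ℝ} (hA : 0 < A) (hB : 0 < B) (hC : 0 < C) :
    let G : ℝ → ℝ := fun s => -2 * (A * B * C) * ((1 - s) * √(1 - s)) /
      √((A ^ 2 * (1 - s) + s) * (B ^ 2 * (1 - s) + s) * (C ^ 2 * (1 - s) + s))
    G 1 - G 0 = 2 := by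
  intro G
  have hABC : 0 < A * B * C := mul_pos (mul_pos hA hB) hC
  have h0 : G 0 = -2 := by
    have h : √(A ^ 2 * B ^ 2 * C ^ 2) = A * B * C := by
      rw [show A ^ 2 * B ^ 2 * C ^ 2 = (A * B * C) ^ 2 by ring, Real.sqrt_sq hABC.le]
    simp only [G, sub_zero, Real.sqrt_one, mul_one, add_zero, h]
    rw [mul_div_assoc, div_self hABC.ne', mul_one]
  have h1 : G 1 = 0 := by
    simp only [G, sub_self, zero_mul, mul_zero, zero_div]
  rw [h0, h1]
  norm_num

/-! ### §3 Semialgebraicity of `f` and `G` on `[0,1] ⊆ ℝ¹` -/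

/-- `aeval` of the polynomial `α²(1 − X₀) + X₀ ∈ ℚ[X₀]`. [folklore] -/
theorem aeval_depolDen (α : ℚ) (x : Fin 1 → ℝ) :
    aeval x (C (α ^ 2) * (1 - X 0) + X 0 : MvPolynomial (Fin 1) ℚ) =
      (α : ℝ) ^ 2 * (1 - x 0) + x 0 := by
  simp only [map_add, map_mul, map_sub, map_one, MvPolynomial.aeval_C, MvPolynomial.aeval_X,
    eq_ratCast, Rat.cast_pow]

/-- `√(1 − x₀)` is `ℚ`-semialgebraic on `[0,1] ⊆ ℝ¹`. [folklore] -/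
theorem isSemialgebraicFunOn_sqrt_one_sub :
    IsSemialgebraicFunOn ℚ {x : Fin 1 → ℝ | x 0 ∈ Icc (0:ℝ) 1} (fun x => √(1 - x 0)) :=
  (IsSemialgebraicFunOn.sqrt_holds
    (isSemialgebraicFunOn_aeval KZ.isSemialgebraic_setOf_apply_mem_Icc (1 - X 0))).congr
    fun x _ => by simp

/-- `1/√(D_a D_b D_c)` is `ℚ`-semialgebraic on `[0,1] ⊆ ℝ¹` for rational `a, b, c > 0`
(`isSemialgebraicFunOn_of_eqOn_inv_sqrt`: it is `√P · (1/P)` with `P > 0` there). [folklore] -/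
theorem isSemialgebraicFunOn_inv_sqrt_depolProd {a b c : ℚ} (ha : 0 < a) (hb : 0 < b)
    (hc : 0 < c) :
    IsSemialgebraicFunOn ℚ {x : Fin 1 → ℝ | x 0 ∈ Icc (0:ℝ) 1} (fun x =>
      (√(((a:ℝ) ^ 2 * (1 - x 0) + x 0) * ((b:ℝ) ^ 2 * (1 - x 0) + x 0) *
        ((c:ℝ) ^ 2 * (1 - x 0) + x 0)))⁻¹) := by
  have hA : (0:ℝ) < a := by exact_mod_cast ha
  have hB : (0:ℝ) < b := by exact_mod_cast hb
  have hC : (0:ℝ) < c := by exact_mod_cast hc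
  refine isSemialgebraicFunOn_of_eqOn_inv_sqrt KZ.isSemialgebraic_setOf_apply_mem_Icc
    ((C (a ^ 2) * (1 - X 0) + X 0) * (C (b ^ 2) * (1 - X 0) + X 0) * (C (c ^ 2) * (1 - X 0) + X 0))
    (fun x hx => ?_) (fun x _ => ?_)
  · rw [map_mul, map_mul, aeval_depolDen, aeval_depolDen, aeval_depolDen]
    exact depol_prod_pos hA hB hC hx.1 hx.2
  · rw [map_mul, map_mul, aeval_depolDen, aeval_depolDen, aeval_depolDen]

/-- **The integrand `f` is `ℚ`-semialgebraic on `[0,1] ⊆ ℝ¹`** (rational `a, b, c > 0`): a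
product of the constant `abc`, `√(1 − x₀)`, `1/√(D_a D_b D_c)` and the rational function
`1/D_a + 1/D_b + 1/D_c` (Tarski–Seidenberg). [cite: BCR1998, §2.2] -/
theorem isSemialgebraicFunOn_depolIntegrand {a b c : ℚ} (ha : 0 < a) (hb : 0 < b) (hc : 0 < c) :
    IsSemialgebraicFunOn ℚ {x : Fin 1 → ℝ | x 0 ∈ Icc (0:ℝ) 1} (fun x =>
      (a * b * c : ℝ) * √(1 - x 0) /
          √(((a:ℝ) ^ 2 * (1 - x 0) + x 0) * ((b:ℝ) ^ 2 * (1 - x 0) + x 0) *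
            ((c:ℝ) ^ 2 * (1 - x 0) + x 0)) *
        (1 / ((a:ℝ) ^ 2 * (1 - x 0) + x 0) + 1 / ((b:ℝ) ^ 2 * (1 - x 0) + x 0) +
          1 / ((c:ℝ) ^ 2 * (1 - x 0) + x 0))) := by
  have hS : IsSemialgebraic ℚ {x : Fin 1 → ℝ | x 0 ∈ Icc (0:ℝ) 1} :=
    KZ.isSemialgebraic_setOf_apply_mem_Icc
  have hpos : ∀ α : ℚ, 0 < α → ∀ x ∈ {x : Fin 1 → ℝ | x 0 ∈ Icc (0:ℝ) 1},
      0 < (α:ℝ) ^ 2 * (1 - x 0) + x 0 :=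
    fun α hα x hx => depol_den_pos (by exact_mod_cast hα) hx.1 hx.2
  have hk : IsSemialgebraicFunOn ℚ {x : Fin 1 → ℝ | x 0 ∈ Icc (0:ℝ) 1}
      (fun _ => (a * b * c : ℝ)) :=
    (isSemialgebraicFunOn_aeval hS (C (a * b * c))).congr fun x _ => by
      simp only [MvPolynomial.aeval_C, eq_ratCast, Rat.cast_mul]
  have hd : ∀ α : ℚ, 0 < α → IsSemialgebraicFunOn ℚ {x : Fin 1 → ℝ | x 0 ∈ Icc (0:ℝ) 1}
      (fun x => 1 / ((α:ℝ) ^ 2 * (1 - x 0) + x 0)) := fun α hα =>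
    (isSemialgebraicFunOn_aeval_div_aeval hS 1 (C (α ^ 2) * (1 - X 0) + X 0) fun x hx => by
      rw [aeval_depolDen]; exact (hpos α hα x hx).ne').congr fun x _ => by
        simp only [map_one, aeval_depolDen]
  have hsum := IsSemialgebraicFunOn.add_holds (IsSemialgebraicFunOn.add_holds (hd a ha) (hd b hb))
    (hd c hc)
  refine ((IsSemialgebraicFunOn.mul_holds (IsSemialgebraicFunOn.mul_holds
    (IsSemialgebraicFunOn.mul_holds hk isSemialgebraicFunOn_sqrt_one_sub)
    (isSemialgebraicFunOn_inv_sqrt_depolProd ha hb hc)) hsum).congr fun x _ => ?_)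
  simp only [Pi.mul_apply, Pi.add_apply]
  ring

/-- **The primitive `G` is `ℚ`-semialgebraic on `[0,1] ⊆ ℝ¹`** (rational `a, b, c > 0`): a
product of the polynomial `−2abc(1 − x₀)`, `√(1 − x₀)` and `1/√(D_a D_b D_c)`.
[cite: BCR1998, §2.2] -/
theorem isSemialgebraicFunOn_depolPrim {a b c : ℚ} (ha : 0 < a) (hb : 0 < b) (hc : 0 < c) :
    IsSemialgebraicFunOn ℚ {x : Fin 1 → ℝ | x 0 ∈ Icc (0:ℝ) 1} (fun x =>
      -2 * ((a:ℝ) * b * c) * ((1 - x 0) * √(1 - x 0)) /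
        √(((a:ℝ) ^ 2 * (1 - x 0) + x 0) * ((b:ℝ) ^ 2 * (1 - x 0) + x 0) *
          ((c:ℝ) ^ 2 * (1 - x 0) + x 0))) := by
  have hS : IsSemialgebraic ℚ {x : Fin 1 → ℝ | x 0 ∈ Icc (0:ℝ) 1} :=
    KZ.isSemialgebraic_setOf_apply_mem_Icc
  have hp : IsSemialgebraicFunOn ℚ {x : Fin 1 → ℝ | x 0 ∈ Icc (0:ℝ) 1}
      (fun x => -2 * ((a:ℝ) * b * c) * (1 - x 0)) :=
    (isSemialgebraicFunOn_aeval hS (C (-2 * (a * b * c)) * (1 - X 0))).congr fun x _ => by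
      simp only [map_mul, map_sub, map_one, MvPolynomial.aeval_C, MvPolynomial.aeval_X, eq_ratCast]
      push_cast
      ring
  refine ((IsSemialgebraicFunOn.mul_holds (IsSemialgebraicFunOn.mul_holds hp
    isSemialgebraicFunOn_sqrt_one_sub) (isSemialgebraicFunOn_inv_sqrt_depolProd ha hb hc)).congr
    fun x _ => ?_)
  simp only [Pi.mul_apply]
  ring

/-! ### §4 The glue: pinned `[(0,1), g] ∼ [pt, v]` from ONE Newton–Leibniz move over the point -/

/-- **Newton–Leibniz over the point, for pinned representations.** Let `r = [(0,1), g]` be pinned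
by its domain `{x | x 0 ∈ (0,1)}` and its integrand `g(x 0)` on it, and `r' = [pt, v]` by its domain
`univ ⊆ ℝ⁰` and the constant integrand `v`. If `g` and a primitive `F` are `ℚ`-semialgebraic on
`[0,1]` (first-coordinate spelling), `F` is continuous on `[0,1]` with `F' = g` on `(0,1)` and
`F(1) − F(0) = v`, then `r ∼ r'`: the band representation `D = [[0,1], g]` (integrable since `r` is
and `{0,1}` is null) satisfies `[D] − [r'] ∈ KZ.newtonLeibnizRel` (ONE move, `n = 0`, `a = 0`,
`b = 1`), `[D] − [D|(0,1)] ∈ relations` (null boundary) and `[D|(0,1)] − [r] ∈ relations`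
(same integrand on the domain). [cite: KontsevichZagier2001, §1.2 rule (3)] -/
theorem equivalent_of_newtonLeibniz_point {F g : ℝ → ℝ} {v : ℝ} {r : KZ.IntegralRep 1}
    {r' : KZ.IntegralRep 0} (hd : r.domain = {x | x 0 ∈ Ioo (0:ℝ) 1})
    (hi : EqOn r.integrand (fun x => g (x 0)) r.domain) (hd' : r'.domain = univ)
    (hi' : EqOn r'.integrand (fun _ => v) r'.domain)
    (hgs : IsSemialgebraicFunOn ℚ {x : Fin 1 → ℝ | x 0 ∈ Icc (0:ℝ) 1} (fun x => g (x 0)))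
    (hFs : IsSemialgebraicFunOn ℚ {x : Fin 1 → ℝ | x 0 ∈ Icc (0:ℝ) 1} (fun x => F (x 0)))
    (hFc : ContinuousOn F (Icc (0:ℝ) 1)) (hFg : ∀ t ∈ Ioo (0:ℝ) 1, HasDerivAt F (g t) t)
    (hv : F 1 - F 0 = v) :
    KZ.Equivalent r r' := by
  set I : Set (Fin 1 → ℝ) := {x | x 0 ∈ Icc (0:ℝ) 1} with hI
  set U : Set (Fin 1 → ℝ) := {x | x 0 ∈ Ioo (0:ℝ) 1} with hU
  have hIs : IsSemialgebraic ℚ I := KZ.isSemialgebraic_setOf_apply_mem_Icc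
  have hUs : IsSemialgebraic ℚ U := KZ.BallPeeling.isSemialgebraic_posIoo
  have hUI : U ⊆ I := fun x hx => ⟨hx.1.le, hx.2.le⟩
  have hUm : MeasurableSet U :=
    Literature.ModelTheory.ExponentialFields.IsSemialgebraic.measurableSet_holds hUs
  -- the band integrand `g (x 0)` is integrable on `[0,1]`: it is on `(0,1)` (as `r` is), and the
  -- two boundary points are null
  have hgU : IntegrableOn (fun x : Fin 1 → ℝ => g (x 0)) U := by
    have h := r.integrableOn.congr_fun hi (by rw [hd]; exact hUm)
    rwa [hd] at h
  have hgI : IntegrableOn (fun x : Fin 1 → ℝ => g (x 0)) I := by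
    refine hgU.congr_set_ae (ae_eq_set.2 ⟨KZ.volume_setOf_Icc_diff_Ioo, ?_⟩)
    exact measure_mono_null (fun x hx => (hx.2 (hUI hx.1)).elim) measure_empty
  -- the band representation `D = [[0,1], g]`
  obtain ⟨D, hDd, hDi⟩ : ∃ D : KZ.IntegralRep 1, D.domain = I ∧ D.integrand = fun x => g (x 0) :=
    ⟨⟨I, _, hIs, hgs, hgI⟩, rfl, rfl⟩
  have hsnoc : ∀ (x : Fin 0 → ℝ) (t : ℝ), (Fin.snoc x t : Fin 1 → ℝ) 0 = t := fun x t => by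
    rw [← Fin.last_zero, Fin.snoc_last]
  -- ONE Newton–Leibniz move over the point: `[D] − [r'] ∈ newtonLeibnizRel`
  have hNL : KZ.of D - KZ.of r' ∈ KZ.newtonLeibnizRel := by
    refine ⟨0, D, r', fun _ => (0:ℝ), fun _ => (1:ℝ), fun z => F (z 0), hDd ▸ hFs, ?_, ?_,
      fun _ _ => zero_le_one, ?_, ?_, ?_, ?_, rfl⟩
    · rw [hd']
      exact (isSemialgebraicFunOn_aeval isSemialgebraic_univ (0 : MvPolynomial (Fin 0) ℚ)).congr
        fun x _ => by simp
    · rw [hd']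
      exact (isSemialgebraicFunOn_aeval isSemialgebraic_univ (1 : MvPolynomial (Fin 0) ℚ)).congr
        fun x _ => by simp
    · rw [hDd, hd', hI]
      ext z
      simp only [mem_setOf_eq, mem_univ, true_and, Fin.last_zero, mem_Icc]
    · intro x _
      simp only [hsnoc]
      exact hFc
    · intro x _ t ht
      have ht' : t ∈ Ioo (0:ℝ) 1 := ht
      simp only [hsnoc, hDi]
      exact hFg t ht'
    · intro x hx
      simp only [hsnoc]
      rw [hi' hx]
      exact hv.symm
  -- glue: `[r] − [r'] = ([D] − [r']) − ([D] − [D|U]) − ([D|U] − [r])`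
  have h1 : KZ.of D - KZ.of r' ∈ KZ.relations := KZ.newtonLeibnizRel_subset_relations hNL
  have hUD : U ⊆ D.domain := by rw [hDd]; exact hUI
  have hvol : volume (D.domain \ U) = 0 := by rw [hDd]; exact KZ.volume_setOf_Icc_diff_Ioo
  have h2 := D.of_sub_of_restrict_mem_relations hUs hUD hvol
  have h3 : KZ.of (D.restrict U hUs hUD) - KZ.of r ∈ KZ.relations :=
    KZ.of_sub_of_mem_relations_of_eqOn (by rw [hd]; rfl) fun x hx => by
      rw [KZ.IntegralRep.integrand_restrict, hDi]
      have hxr : x ∈ r.domain := by rw [hd]; exact hx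
      exact (hi hxr).symm
  have h := KZ.relations.sub_mem (KZ.relations.sub_mem h1 h2) h3
  have e : KZ.of D - KZ.of r' - (KZ.of D - KZ.of (D.restrict U hUs hUD)) -
      (KZ.of (D.restrict U hUs hUD) - KZ.of r) = KZ.of r - KZ.of r' := by abel
  rw [e] at h
  exact h

/-! ### §5 The stub -/

/-- **`DepolarisationSum` inside the Kontsevich–Zagier calculus** (stub 74
`tateLifting_depolarisationSum` of the line `Sketch` of the crux `TateLifting`,
stmt-KontsevichZagierPeriods-9129; verbatim the item stmt-KontsevichZagierPeriods-5153
`DepolarisationSum` of route `VietaFibre`). For rationals `a, b, c > 0` and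
`D_α(x) = α²(1 − x) + x`, every representation `r = [(0,1), abc √(1−x)/√(D_a D_b D_c) ·
(1/D_a + 1/D_b + 1/D_c)]` (pinned by domain and integrand on it) is equivalent to every
`r' = [pt, 2]`: ONE Newton–Leibniz move over the point with the algebraic primitive
`G(x) = −2abc (1 − x)^{3/2}/√(D_a D_b D_c)` (`G' =` integrand on `(0,1)`, `G` continuous on
`[0,1]`, `G(1) − G(0) = 0 − (−2) = 2`), plus the null boundary and congruence of integrands
(`equivalent_of_newtonLeibniz_point`). [cite: KontsevichZagier2001, §1.2] -/
theorem tateLifting_depolarisationSum :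
    ∀ (a b c : ℚ) (r : KZ.IntegralRep 1) (r' : KZ.IntegralRep 0), 0 < a → 0 < b → 0 < c →
      r.domain = {x | x 0 ∈ Set.Ioo (0 : ℝ) 1} →
      Set.EqOn r.integrand (fun x => (a * b * c : ℝ) * Real.sqrt (1 - x 0) /
        Real.sqrt ((a ^ 2 * (1 - x 0) + x 0) * (b ^ 2 * (1 - x 0) + x 0) * (c ^ 2 * (1 - x 0) + x 0)) *
        (1 / (a ^ 2 * (1 - x 0) + x 0) + 1 / (b ^ 2 * (1 - x 0) + x 0) + 1 / (c ^ 2 * (1 - x 0) + x 0)))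
        r.domain →
      r'.domain = Set.univ → Set.EqOn r'.integrand (fun _ => 2) r'.domain → KZ.Equivalent r r' := by
  intro a b c r r' ha hb hc hd hi hd' hi'
  have hA : (0:ℝ) < a := by exact_mod_cast ha
  have hB : (0:ℝ) < b := by exact_mod_cast hb
  have hC : (0:ℝ) < c := by exact_mod_cast hc
  exact equivalent_of_newtonLeibniz_point
    (F := fun s : ℝ => -2 * ((a:ℝ) * b * c) * ((1 - s) * √(1 - s)) /
      √(((a:ℝ) ^ 2 * (1 - s) + s) * ((b:ℝ) ^ 2 * (1 - s) + s) * ((c:ℝ) ^ 2 * (1 - s) + s)))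
    (g := fun s : ℝ => (a * b * c : ℝ) * √(1 - s) /
        √(((a:ℝ) ^ 2 * (1 - s) + s) * ((b:ℝ) ^ 2 * (1 - s) + s) * ((c:ℝ) ^ 2 * (1 - s) + s)) *
      (1 / ((a:ℝ) ^ 2 * (1 - s) + s) + 1 / ((b:ℝ) ^ 2 * (1 - s) + s) +
        1 / ((c:ℝ) ^ 2 * (1 - s) + s)))
    hd hi hd' hi' (isSemialgebraicFunOn_depolIntegrand ha hb hc)
    (isSemialgebraicFunOn_depolPrim ha hb hc) (continuousOn_depolPrim hA hB hC)
    (fun t ht => hasDerivAt_depolPrim hA hB hC ht) (depolPrim_one_sub_depolPrim_zero hA hB hC)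

end Summit.KontsevichZagierPeriods.InverseLandau

end
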